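import Literature.Probability.RandomPlanarGeometry.ConformalTube
import Literature.Probability.RandomPlanarGeometry.JordanIndex
import Mathlib.Topology.Algebra.Order.Floor
import HarnessLib

/-!
# Collar domains of a conformal rectangle

Topic `Literature/Probability/RandomPlanarGeometry`; family `conformal-planar`. Given a conformal
rectangle `R` (a Jordan domain `Ω` with four marked boundary points `P₀, …, P₃`), tube data `T`
(`ConformalTube.lean`), signs `σ : Fin 4 → ℝ` with `|σ i| ≤ 1` and a width `h ∈ (0, 1/2]`, the
**collar domain** `collarRect R T σ h` is the conformal rectangle bounded by the loop
`t ↦ tube (1 + h · σᵢ · bumpᵢ(t)) t` — the boundary of `Ω` pushed *outwards* along the arcs with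
`σᵢ > 0` and *inwards* along the arcs with `σᵢ < 0`, through the corners `Pᵢ` (where the bumps
vanish), with the same marks. For `σ = (+, -, +, -)` this is the "longer, thinner" domain `D'` and
for `σ = (-, +, -, +)` the "shorter, fatter" domain `D''` of Bollobás–Riordan, *Percolation*
(2006), Ch. 7 p. 186 and Figure 14 (which the source cuts out with sausage neighbourhoods of the
arcs; the tubular construction gives Jordan domains directly).

Proved here: the loop is continuous, `1`-periodic and simple (`ofLoop` applies); the corners are
the `Pᵢ`; the boundary is uniformly close to `∂Ω` for small `h` (`dist_collarLoop_lt`); when it is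
closer than the depth of the centre `z₀`, the centre lies inside and the collar domain has the
same index as `R` (`z₀_mem_collarRect`, `index_collarRect`); the tube ray through `∂Ω(t)` meets
the loop only at the profile value (`tube_mem_range_collarLoop_iff`), so tube points below the
profile are inside and tube points above it are outside (`tube_mem_collarRect`,
`tube_not_mem_collarRect`); consequently the deep interior `Φ(B(0, 1 - h))` is inside, and every
point of the collar domain outside `closure Ω` is a tube point `tube s t` with `1 < s < profile t`
(`exists_eq_tube_of_mem_of_not_mem_closure`).

## References

* B. Bollobás, O. Riordan, *Percolation*, Cambridge University Press (2006), Ch. 7 p. 186, Fig. 14.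

## Mathlib / tree

Mathlib: `Int.fract`, `ContinuousOn.comp_fract''`, `connectedComponentIn`. Tree: `ConformalTube`
(`TubeData.tube` and its API), `PolygonalDomains` (`JordanDomain.ofLoop`, `mem_ofLoop_carrier_iff`),
`JordanIndex` (`index`, `index_eq_zero_of_mem_exterior`, `index_ne_zero_of_mem_carrier`),
`WindingNumber` (`wind_eq_of_norm_sub_lt`).
-/

noncomputable section

open Set Metric Topology Filter Bornology

namespace Literature.Probability.RandomPlanarGeometry

namespace MarkedDomain

variable (R : ConformalRectangle)

/-! ### The profile -/

/-- The bump `max 0 (4 (τ - a)(b - τ)/(b - a)²)`: continuous, supported in `[a, b]`, vanishing at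
`a` and `b`, with values in `[0, 1]`. [folklore] -/
def bump (a b τ : ℝ) : ℝ := max 0 (4 * (τ - a) * (b - τ) / (b - a) ^ 2)

/-- The bump is continuous. [folklore] -/
@[fun_prop] theorem continuous_bump (a b : ℝ) : Continuous (bump a b) := by
  unfold bump; fun_prop

/-- The bump is nonnegative. [folklore] -/
theorem bump_nonneg (a b τ : ℝ) : 0 ≤ bump a b τ := le_max_left _ _

/-- The bump is at most `1`. [folklore] -/
theorem bump_le_one (a b τ : ℝ) : bump a b τ ≤ 1 := by
  refine max_le zero_le_one ?_
  rcases eq_or_ne (b - a) 0 with h | h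
  · rw [h]; simp
  · rw [div_le_one (by positivity)]
    nlinarith [sq_nonneg (2 * τ - a - b)]

/-- The bump vanishes off `(a, b)`. [folklore] -/
theorem bump_eq_zero {a b τ : ℝ} (hab : a ≤ b) (h : τ ≤ a ∨ b ≤ τ) : bump a b τ = 0 := by
  refine max_eq_left (div_nonpos_of_nonpos_of_nonneg ?_ (sq_nonneg _))
  rcases h with h | h <;> nlinarith

/-- The bump is positive on `(a, b)`. [folklore] -/
theorem bump_pos {a b τ : ℝ} (ha : a < τ) (hb : τ < b) : 0 < bump a b τ :=
  lt_max_of_lt_right (div_pos (by nlinarith) (by nlinarith))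

/-- The signed bump sum on the fundamental window `[mark 0, mark 0 + 1]`. [folklore] -/
def bumpSum (σ : Fin 4 → ℝ) (τ : ℝ) : ℝ := ∑ i, σ i * bump (R.mark i) (R.nextMark i) τ

/-- **The profile** `1 + h · Σᵢ σᵢ bumpᵢ`, made `1`-periodic through the fundamental window.
[cite: BollobasRiordan2006, Ch. 7 p. 186] -/
def profile (σ : Fin 4 → ℝ) (h t : ℝ) : ℝ := 1 + h * R.bumpSum σ (R.mark 0 + Int.fract (t - R.mark 0))

/-- The marks of a conformal rectangle, unfolded (generic restatement, in the `RandomPlanarGeometry` layer, of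
`Percolation.cr_marks` of `TriBoundaryZoneOrder.lean`, which lives downstream in the percolation layer and is
not importable here). [folklore] -/
theorem marks_chain : 0 ≤ R.mark 0 ∧ R.mark 0 < R.mark 1 ∧ R.mark 1 < R.mark 2 ∧ R.mark 2 < R.mark 3 ∧ R.mark 3 < R.mark 0 + 1 := by
  refine ⟨(R.mark_mem 0).1, R.strictMono_mark (by decide), R.strictMono_mark (by decide), R.strictMono_mark (by decide), ?_⟩
  have := (R.mark_mem 3).2; have := (R.mark_mem 0).1; linarith

/-- The next marks of a conformal rectangle, unfolded (generic restatement of the downstream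
`Percolation.cr_nextMark`, see `marks_chain`). [folklore] -/
theorem nextMarks_eq : R.nextMark 0 = R.mark 1 ∧ R.nextMark 1 = R.mark 2 ∧ R.nextMark 2 = R.mark 3 ∧ R.nextMark 3 = R.mark 0 + 1 := by
  refine ⟨?_, ?_, ?_, ?_⟩
  · rw [R.nextMark_of_lt 0 (by decide)]; rfl
  · rw [R.nextMark_of_lt 1 (by decide)]; rfl
  · rw [R.nextMark_of_lt 2 (by decide)]; rfl
  · rw [R.nextMark_of_not_lt 3 (by decide)]

/-- Every arc parameter range lies in the fundamental window. [folklore] -/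
theorem mark_zero_le_mark (i : Fin 4) : R.mark 0 ≤ R.mark i ∧ R.nextMark i ≤ R.mark 0 + 1 := by
  obtain ⟨h0, h1, h2, h3, h4⟩ := R.marks_chain
  obtain ⟨n0, n1, n2, n3⟩ := R.nextMarks_eq
  refine ⟨R.strictMono_mark.monotone (Fin.zero_le i), ?_⟩
  match i with
  | 0 => rw [n0]; linarith
  | 1 => rw [n1]; linarith
  | 2 => rw [n2]; linarith
  | 3 => rw [n3]

/-- The bump sum vanishes at the ends of the fundamental window. [folklore] -/
theorem bumpSum_mark_zero (σ : Fin 4 → ℝ) : R.bumpSum σ (R.mark 0) = 0 ∧ R.bumpSum σ (R.mark 0 + 1) = 0 := by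
  constructor <;> refine Finset.sum_eq_zero fun i _ => ?_ <;>
    rw [bump_eq_zero (R.mark_lt_nextMark i).le ?_, mul_zero]
  · exact Or.inl (R.mark_zero_le_mark i).1
  · exact Or.inr (R.mark_zero_le_mark i).2

/-- The bump sum is bounded by `1` in absolute value when `|σᵢ| ≤ 1` (the bumps have disjoint
open supports). [folklore] -/
theorem abs_bumpSum_le {σ : Fin 4 → ℝ} (hσ : ∀ i, |σ i| ≤ 1) (τ : ℝ) : |R.bumpSum σ τ| ≤ 1 := by
  obtain ⟨h0, h1, h2, h3, h4⟩ := R.marks_chain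
  obtain ⟨n0, n1, n2, n3⟩ := R.nextMarks_eq
  -- at most one bump is nonzero at `τ`
  have hterm : ∀ i, |σ i * bump (R.mark i) (R.nextMark i) τ| ≤ bump (R.mark i) (R.nextMark i) τ := fun i => by
    rw [abs_mul, abs_of_nonneg (bump_nonneg _ _ _)]
    exact mul_le_of_le_one_left (bump_nonneg _ _ _) (hσ i)
  have hsum : |R.bumpSum σ τ| ≤ ∑ i, bump (R.mark i) (R.nextMark i) τ :=
    (Finset.abs_sum_le_sum_abs _ _).trans (Finset.sum_le_sum fun i _ => hterm i)
  refine hsum.trans ?_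
  simp only [Fin.sum_univ_four, n0, n1, n2, n3]
  have b0 := bump_le_one (R.mark 0) (R.mark 1) τ
  have b1 := bump_le_one (R.mark 1) (R.mark 2) τ
  have b2 := bump_le_one (R.mark 2) (R.mark 3) τ
  have b3 := bump_le_one (R.mark 3) (R.mark 0 + 1) τ
  rcases le_or_gt τ (R.mark 1) with t1 | t1
  · rw [bump_eq_zero h2.le (Or.inl t1), bump_eq_zero h3.le (Or.inl (by linarith)), bump_eq_zero h4.le (Or.inl (by linarith))]
    linarith
  rcases le_or_gt τ (R.mark 2) with t2 | t2
  · rw [bump_eq_zero h1.le (Or.inr t1.le), bump_eq_zero h3.le (Or.inl t2), bump_eq_zero h4.le (Or.inl (by linarith))]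
    linarith
  rcases le_or_gt τ (R.mark 3) with t3 | t3
  · rw [bump_eq_zero h1.le (Or.inr t1.le), bump_eq_zero h2.le (Or.inr t2.le), bump_eq_zero h4.le (Or.inl t3)]
    linarith
  · rw [bump_eq_zero h1.le (Or.inr t1.le), bump_eq_zero h2.le (Or.inr t2.le), bump_eq_zero h3.le (Or.inr t3.le)]
    linarith

/-- The bump sum is continuous. [folklore] -/
theorem continuous_bumpSum (σ : Fin 4 → ℝ) : Continuous (R.bumpSum σ) := by
  unfold bumpSum; fun_prop

/-- **The profile is continuous** (the bump sum vanishes at both ends of the window). [folklore] -/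
theorem continuous_profile (σ : Fin 4 → ℝ) (h : ℝ) : Continuous (R.profile σ h) := by
  have hF : Continuous ((fun x => R.bumpSum σ (R.mark 0 + x)) ∘ Int.fract) := by
    refine ContinuousOn.comp_fract'' ((R.continuous_bumpSum σ).comp (continuous_const.add continuous_id)).continuousOn ?_
    simp only [add_zero]
    rw [(R.bumpSum_mark_zero σ).1, (R.bumpSum_mark_zero σ).2]
  exact continuous_const.add (continuous_const.mul (hF.comp (continuous_id.sub continuous_const)))

/-- The profile is `1`-periodic. [folklore] -/
theorem periodic_profile (σ : Fin 4 → ℝ) (h : ℝ) : Function.Periodic (R.profile σ h) 1 := fun t => by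
  simp only [profile, show t + 1 - R.mark 0 = t - R.mark 0 + 1 by ring, Int.fract_add_one]

/-- `|profile - 1| ≤ h` when `|σᵢ| ≤ 1` and `h ≥ 0`. [folklore] -/
theorem abs_profile_sub_one_le {σ : Fin 4 → ℝ} (hσ : ∀ i, |σ i| ≤ 1) {h : ℝ} (hh : 0 ≤ h) (t : ℝ) :
    |R.profile σ h t - 1| ≤ h := by
  rw [profile, add_sub_cancel_left, abs_mul, abs_of_nonneg hh]
  exact mul_le_of_le_one_right hh (R.abs_bumpSum_le hσ _)

/-- On the fundamental window the profile is `1 + h · bumpSum`. [folklore] -/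
theorem profile_of_mem_window (σ : Fin 4 → ℝ) (h : ℝ) {t : ℝ} (ht : R.mark 0 ≤ t) (ht1 : t < R.mark 0 + 1) :
    R.profile σ h t = 1 + h * R.bumpSum σ t := by
  rw [profile, Int.fract_eq_self.2 ⟨by linarith, by linarith⟩, add_sub_cancel]

/-- The profile is `1` at the marks (and hence at the next marks). [folklore] -/
theorem profile_mark (σ : Fin 4 → ℝ) (h : ℝ) (i : Fin 4) : R.profile σ h (R.mark i) = 1 := by
  obtain ⟨h0, h1, h2, h3, h4⟩ := R.marks_chain
  obtain ⟨n0, n1, n2, n3⟩ := R.nextMarks_eq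
  have hw := R.mark_zero_le_mark i
  have hlt : R.mark i < R.mark 0 + 1 := (R.mark_lt_nextMark i).trans_le hw.2
  rw [R.profile_of_mem_window σ h hw.1 hlt]
  suffices R.bumpSum σ (R.mark i) = 0 by rw [this, mul_zero, add_zero]
  refine Finset.sum_eq_zero fun j _ => ?_
  rw [bump_eq_zero (R.mark_lt_nextMark j).le ?_, mul_zero]
  fin_cases i <;> fin_cases j <;> simp only [n0, n1, n2, n3, Fin.zero_eta, Fin.mk_one, Fin.reduceFinMk, Fin.isValue] <;>
    first | exact Or.inl le_rfl | exact Or.inr le_rfl | (left; linarith) | (right; linarith)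

/-- The profile at the next mark is `1`. [folklore] -/
theorem profile_nextMark (σ : Fin 4 → ℝ) (h : ℝ) (i : Fin 4) : R.profile σ h (R.nextMark i) = 1 := by
  obtain ⟨n0, n1, n2, n3⟩ := R.nextMarks_eq
  fin_cases i <;> simp only [n0, n1, n2, n3, Fin.zero_eta, Fin.mk_one, Fin.reduceFinMk, Fin.isValue]
  · exact R.profile_mark σ h 1
  · exact R.profile_mark σ h 2
  · exact R.profile_mark σ h 3
  · rw [R.periodic_profile]; exact R.profile_mark σ h 0

/-- **On the open `i`-th parameter range the profile is `1 + h σᵢ bumpᵢ`** with a positive bump.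
[folklore] -/
theorem profile_of_mem_Ioo (σ : Fin 4 → ℝ) (h : ℝ) {i : Fin 4} {t : ℝ} (ht : t ∈ Ioo (R.mark i) (R.nextMark i)) :
    R.profile σ h t = 1 + h * (σ i * bump (R.mark i) (R.nextMark i) t) ∧ 0 < bump (R.mark i) (R.nextMark i) t := by
  obtain ⟨h0, h1, h2, h3, h4⟩ := R.marks_chain
  obtain ⟨n0, n1, n2, n3⟩ := R.nextMarks_eq
  have hw := R.mark_zero_le_mark i
  refine ⟨?_, bump_pos ht.1 ht.2⟩
  rw [R.profile_of_mem_window σ h (hw.1.trans ht.1.le) (ht.2.trans_le hw.2)]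
  congr 1; congr 1
  rw [bumpSum, ← Finset.sum_erase_add _ _ (Finset.mem_univ i)]
  rw [Finset.sum_eq_zero, zero_add]
  intro j hj
  rw [Finset.mem_erase] at hj
  rw [bump_eq_zero (R.mark_lt_nextMark j).le ?_, mul_zero]
  obtain ⟨ha, hb⟩ := ht
  fin_cases i <;> fin_cases j <;> simp only [n0, n1, n2, n3, Fin.zero_eta, Fin.mk_one, Fin.reduceFinMk, Fin.isValue] at hj ha hb ⊢ <;>
    first | exact absurd rfl hj.1 | (left; linarith) | (right; linarith)

/-! ### The collar loop and the collar domain -/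

variable (T : R.toJordanDomain.TubeData)

/-- **The collar loop** `t ↦ tube (profile t) t`. [cite: BollobasRiordan2006, Ch. 7 p. 186] -/
def collarLoop (σ : Fin 4 → ℝ) (h t : ℝ) : ℂ := T.tube (R.profile σ h t) t

/-- Profile bounds `1 - h ≤ profile ≤ 1 + h`. [folklore] -/
theorem profile_mem {σ : Fin 4 → ℝ} (hσ : ∀ i, |σ i| ≤ 1) {h : ℝ} (hh : 0 < h) (t : ℝ) :
    1 - h ≤ R.profile σ h t ∧ R.profile σ h t ≤ 1 + h := by
  have := abs_le.1 (R.abs_profile_sub_one_le hσ hh.le t)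
  constructor <;> linarith [this.1, this.2]

/-- The profile is invariant under `Int.fract`. [folklore] -/
theorem profile_fract (σ : Fin 4 → ℝ) (h t : ℝ) : R.profile σ h (Int.fract t) = R.profile σ h t := by
  have := (R.periodic_profile σ h).int_mul (-⌊t⌋) t
  rw [← this]
  congr 1
  rw [Int.fract]; push_cast; ring

variable {σ : Fin 4 → ℝ} (hσ : ∀ i, |σ i| ≤ 1) {h : ℝ} (hh : 0 < h) (hh1 : h ≤ 1 / 2)
include hσ hh hh1

/-- The collar loop is continuous. [folklore] -/
theorem continuous_collarLoop : Continuous (R.collarLoop T σ h) :=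
  T.continuous_tube_comp (R.continuous_profile σ h) (fun t => by linarith [(R.profile_mem hσ hh t).1])
    fun t => by linarith [(R.profile_mem hσ hh t).2]

omit hσ hh hh1 in
/-- The tube is `1`-periodic in the boundary parameter. [folklore] -/
theorem tube_add_one (s t : ℝ) : T.tube s (t + 1) = T.tube s t := by
  simp only [JordanDomain.TubeData.tube, T.Ci.periodic_β t, T.Ce.periodic_β t]

omit hσ hh hh1 in
/-- The tube is `1`-periodic in the boundary parameter (integer shifts). [folklore] -/
theorem tube_add_int (s t : ℝ) (n : ℤ) : T.tube s (t + n) = T.tube s t := by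
  have hp : Function.Periodic (fun t => T.tube s t) 1 := fun t => R.tube_add_one T s t
  exact hp.int_mul n t ▸ by simp

omit hσ hh hh1 in
/-- The tube is invariant under `Int.fract` of the boundary parameter. [folklore] -/
theorem tube_fract (s t : ℝ) : T.tube s (Int.fract t) = T.tube s t := by
  rw [← R.tube_add_int T s t (-⌊t⌋)]
  congr 1
  rw [Int.fract]; push_cast; ring

omit hσ hh hh1 in
/-- The collar loop is `1`-periodic. [folklore] -/
theorem periodic_collarLoop : Function.Periodic (R.collarLoop T σ h) 1 := fun t => by
  simp only [collarLoop, R.periodic_profile σ h t, R.tube_add_one T]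

/-- The collar loop is injective on a period. [folklore] -/
theorem injOn_collarLoop : InjOn (R.collarLoop T σ h) (Ico 0 1) := by
  intro t ht t' ht' he
  have h1 := R.profile_mem hσ hh t
  have h2 := R.profile_mem hσ hh t'
  have key := T.injOn_tube
  have := key (show ((R.profile σ h t, t) : ℝ × ℝ) ∈ {q : ℝ × ℝ | 0 < q.1 ∧ q.1 < 2 ∧ q.2 ∈ Ico (0 : ℝ) 1} from
      ⟨by linarith [h1.1], by linarith [h1.2], ht⟩)
    (show ((R.profile σ h t', t') : ℝ × ℝ) ∈ {q : ℝ × ℝ | 0 < q.1 ∧ q.1 < 2 ∧ q.2 ∈ Ico (0 : ℝ) 1} from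
      ⟨by linarith [h2.1], by linarith [h2.2], ht'⟩) he
  exact congrArg Prod.snd this

/-- **The collar domain** bounded by the collar loop, with the marks of `R`.
[cite: BollobasRiordan2006, Ch. 7 p. 186, Fig. 14] -/
def collarRect : ConformalRectangle where
  toJordanDomain := JordanDomain.ofLoop (R.continuous_collarLoop T hσ hh hh1) (R.periodic_collarLoop T) (R.injOn_collarLoop T hσ hh hh1)
  mark := R.mark
  strictMono_mark := R.strictMono_mark
  mark_mem := R.mark_mem

/-- The boundary of the collar domain is the collar loop. [folklore] -/
@[simp] theorem collarRect_boundary (t : ℝ) : (R.collarRect T hσ hh hh1).boundary t = T.tube (R.profile σ h t) t := rfl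

/-- The marks of the collar domain are those of `R`. [folklore] -/
@[simp] theorem collarRect_mark (i : Fin 4) : (R.collarRect T hσ hh hh1).mark i = R.mark i := rfl

/-- The next marks of the collar domain are those of `R`. [folklore] -/
@[simp] theorem collarRect_nextMark (i : Fin 4) : (R.collarRect T hσ hh hh1).nextMark i = R.nextMark i := rfl

/-- **The corners of the collar domain are the corners of `R`.** [folklore] -/
@[simp] theorem collarRect_pt (i : Fin 4) : (R.collarRect T hσ hh hh1).pt i = R.pt i := by
  rw [MarkedDomain.pt, collarRect_boundary, collarRect_mark, R.profile_mark, T.tube_one]; rfl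

/-- The frontier of the collar domain is the trace of the collar loop. [folklore] -/
theorem frontier_collarRect : frontier (R.collarRect T hσ hh hh1).carrier = range (R.collarLoop T σ h) :=
  (R.collarRect T hσ hh hh1).range_boundary.symm

/-- Membership in the collar domain: off the loop, with bounded complementary component
(`mem_ofLoop_carrier_iff`). [folklore] -/
theorem mem_collarRect_iff {z : ℂ} : z ∈ (R.collarRect T hσ hh hh1).carrier ↔
    z ∉ range (R.collarLoop T σ h) ∧ IsBounded (connectedComponentIn (range (R.collarLoop T σ h))ᶜ z) :=
  JordanDomain.mem_ofLoop_carrier_iff (R.continuous_collarLoop T hσ hh hh1) (R.periodic_collarLoop T) (R.injOn_collarLoop T hσ hh hh1)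

omit hh1 in
/-- **The collar boundary is uniformly close to `∂Ω`**: given `ε > 0`, for all widths `h` below the
threshold of `exists_dist_tube_lt`, `dist (collar boundary (t), ∂Ω(t)) < ε`. [folklore] -/
theorem dist_collarLoop_lt {ε : ℝ} {h₀ : ℝ}
    (hh₀ : ∀ s t, 1 - h₀ ≤ s → s ≤ 1 + h₀ → dist (T.tube s t) (R.boundary t) < ε) (hle : h ≤ h₀) (t : ℝ) :
    dist (R.collarLoop T σ h t) (R.boundary t) < ε := by
  have := R.profile_mem hσ hh t
  exact hh₀ _ _ (by linarith [this.1]) (by linarith [this.2])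

/-! ### The ray through `∂Ω(t)` meets the collar loop once -/

/-- **A tube point `tube s t` (`0 ≤ s < 2`) lies on the collar loop iff `s = profile t`.** [folklore] -/
theorem tube_mem_range_collarLoop_iff {s : ℝ} (hs0 : 0 ≤ s) (hs2 : s < 2) (t : ℝ) :
    T.tube s t ∈ range (R.collarLoop T σ h) ↔ s = R.profile σ h t := by
  constructor
  · rintro ⟨t', ht'⟩
    rw [collarLoop] at ht'
    -- reduce both parameters to `[0, 1)`
    rw [← R.tube_fract T _ t', ← R.profile_fract σ h t', ← R.tube_fract T s t] at ht'
    have hp := R.profile_mem hσ hh (Int.fract t')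
    rcases hs0.eq_or_lt with rfl | hs0'
    · -- `s = 0`: the centre `z₀` is not on the loop
      exfalso
      have hz : T.tube 0 (Int.fract t) = T.z₀ := by
        rw [T.tube_of_le_one zero_le_one, Complex.ofReal_zero, zero_mul, T.Ci_zero]
      rw [hz] at ht'
      rcases le_or_gt (R.profile σ h (Int.fract t')) 1 with hp1 | hp1
      · rw [T.tube_of_le_one hp1] at ht'
        have h0 := T.Ci.eq_zero_of_apply_eq (by
          rw [JordanDomain.TubeData.norm_real_mul_of_norm_eq_one (T.Ci.norm_β _)]; exact abs_le.2 ⟨by linarith [hp.1], hp1⟩)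
          (ht'.trans T.Ci_zero.symm)
        rw [mul_eq_zero, Complex.ofReal_eq_zero] at h0
        rcases h0 with h0 | h0
        · linarith [hp.1]
        · have := T.Ci.norm_β (Int.fract t'); rw [h0, norm_zero] at this; exact zero_ne_one this
      · exact T.tube_not_mem_closure hp1 (by linarith [hp.2]) _ (ht'.symm ▸ subset_closure T.hz₀)
    · have key := T.injOn_tube
      have := key (show ((R.profile σ h (Int.fract t'), Int.fract t') : ℝ × ℝ) ∈ {q : ℝ × ℝ | 0 < q.1 ∧ q.1 < 2 ∧ q.2 ∈ Ico (0 : ℝ) 1}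
          from ⟨by linarith [hp.1], by linarith [hp.2], Int.fract_nonneg _, Int.fract_lt_one _⟩)
        (show ((s, Int.fract t) : ℝ × ℝ) ∈ {q : ℝ × ℝ | 0 < q.1 ∧ q.1 < 2 ∧ q.2 ∈ Ico (0 : ℝ) 1}
          from ⟨hs0', hs2, Int.fract_nonneg _, Int.fract_lt_one _⟩) ht'
      obtain ⟨hps, htt⟩ := Prod.ext_iff.1 this
      simp only at hps htt
      rw [← hps, htt, R.profile_fract]
  · rintro rfl
    exact ⟨t, rfl⟩

/-! ### Inside and outside along the rays -/

variable (hclose : ∀ t, dist (R.collarLoop T σ h t) (R.boundary t) < infDist T.z₀ (frontier R.carrier))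
include hclose

/-- **The centre lies inside the collar domain, which has the index of `R`**, when the collar loop
is closer to `∂Ω` than the depth of the centre (dog-on-leash). [folklore] -/
theorem z₀_mem_collarRect_and_index :
    T.z₀ ∈ (R.collarRect T hσ hh hh1).carrier ∧ (R.collarRect T hσ hh hh1).index T.z₀ = R.index T.z₀ := by
  set C := R.collarRect T hσ hh hh1 with hC
  -- the winding numbers of the two loops about `z₀` agree
  have hwind : C.index T.z₀ = R.index T.z₀ := by
    have hC1 : C.boundary 0 = C.boundary 1 := by have := C.periodic_boundary 0; rw [zero_add] at this; exact this.symm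
    have hR1 : R.boundary 0 = R.boundary 1 := by have := R.periodic_boundary 0; rw [zero_add] at this; exact this.symm
    refine Literature.Topology.PlaneTopology.wind_eq_of_norm_sub_lt
      ((C.continuous_boundary.sub continuous_const).continuousOn) (by rw [hC1])
      ⟨(R.continuous_boundary.sub continuous_const).continuousOn, fun t _ => ?_, by rw [hR1]⟩ fun t _ => ?_
    · exact sub_ne_zero.2 fun h0 => Set.disjoint_left.1 R.disjoint_carrier_frontier T.hz₀
        (by rw [← h0]; exact R.boundary_mem_frontier t)
    · rw [sub_sub_sub_cancel_right, ← dist_eq_norm, ← dist_eq_norm, dist_comm (R.boundary t) T.z₀]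
      exact (hclose t).trans_le (infDist_le_dist_of_mem (R.boundary_mem_frontier t))
  refine ⟨?_, hwind⟩
  -- nonzero index forces `z₀` into the closure, and it is not on the loop
  have hne : C.index T.z₀ ≠ 0 := by rw [hwind]; exact R.index_ne_zero_of_mem_carrier T.hz₀
  have hcl : T.z₀ ∈ closure C.carrier := by
    by_contra hout
    exact hne (C.index_eq_zero_of_mem_exterior hout)
  rw [closure_eq_self_union_frontier] at hcl
  rcases hcl with h | h
  · exact h
  · exfalso
    rw [R.frontier_collarRect T hσ hh hh1] at h
    have h0 : T.tube 0 0 = T.z₀ := by rw [T.tube_of_le_one zero_le_one, Complex.ofReal_zero, zero_mul, T.Ci_zero]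
    rw [← h0, R.tube_mem_range_collarLoop_iff T hσ hh hh1 le_rfl two_pos] at h
    linarith [(R.profile_mem hσ hh 0).1]

/-- The centre lies inside the collar domain. [folklore] -/
theorem z₀_mem_collarRect : T.z₀ ∈ (R.collarRect T hσ hh hh1).carrier := (R.z₀_mem_collarRect_and_index T hσ hh hh1 hclose).1

/-- The collar domain has the index of `R`. [folklore] -/
theorem index_collarRect {z : ℂ} (hz : z ∈ (R.collarRect T hσ hh hh1).carrier) :
    (R.collarRect T hσ hh hh1).index z = R.index T.z₀ := by
  rw [(R.collarRect T hσ hh hh1).index_eq_of_mem_carrier hz (R.z₀_mem_collarRect T hσ hh hh1 hclose)]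
  exact (R.z₀_mem_collarRect_and_index T hσ hh hh1 hclose).2

/-- **Tube points below the profile are inside**: `tube s t ∈ collar` for `0 ≤ s < profile t`.
[folklore] -/
theorem tube_mem_collarRect {s t : ℝ} (hs0 : 0 ≤ s) (hs : s < R.profile σ h t) :
    T.tube s t ∈ (R.collarRect T hσ hh hh1).carrier := by
  have hp := R.profile_mem hσ hh t
  -- the ray piece `{tube σ' t : 0 ≤ σ' ≤ s}` is connected, misses the loop and contains `z₀`
  set S := (fun σ' => T.tube σ' t) '' Icc 0 s with hS
  have hSc : IsConnected S := (isConnected_Icc hs0).image _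
    ((T.continuousOn_tube_left t).mono fun σ' hσ' => ⟨by linarith [hσ'.1], by linarith [hσ'.2, hp.2]⟩)
  have hSmiss : S ⊆ (range (R.collarLoop T σ h))ᶜ := by
    rintro _ ⟨σ', hσ', rfl⟩ hmem
    rw [R.tube_mem_range_collarLoop_iff T hσ hh hh1 hσ'.1 (by linarith [hσ'.2, hp.2])] at hmem
    linarith [hσ'.2]
  have hz₀S : T.z₀ ∈ S := ⟨0, left_mem_Icc.2 hs0, by
    show T.tube 0 t = T.z₀; rw [T.tube_of_le_one zero_le_one, Complex.ofReal_zero, zero_mul, T.Ci_zero]⟩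
  have hzS : T.tube s t ∈ S := ⟨s, right_mem_Icc.2 hs0, rfl⟩
  have hz₀ := R.z₀_mem_collarRect T hσ hh hh1 hclose
  rw [R.mem_collarRect_iff T hσ hh hh1] at hz₀ ⊢
  refine ⟨hSmiss hzS, ?_⟩
  have heq : connectedComponentIn (range (R.collarLoop T σ h))ᶜ (T.tube s t) = connectedComponentIn (range (R.collarLoop T σ h))ᶜ T.z₀ :=
    (connectedComponentIn_eq (hSc.isPreconnected.subset_connectedComponentIn hz₀S hSmiss hzS)).symm
  rw [heq]; exact hz₀.2

omit hclose in
/-- **Tube points above the profile are outside**: `tube s t ∉ collar` for `profile t < s < 2`.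
[folklore] -/
theorem tube_not_mem_collarRect {s t : ℝ} (hs : R.profile σ h t < s) (hs2 : s < 2) :
    T.tube s t ∉ (R.collarRect T hσ hh hh1).carrier := by
  have hp := R.profile_mem hσ hh t
  -- the ray piece `{tube σ' t : s ≤ σ' < 2}` is connected, unbounded and misses the loop
  set S := (fun σ' => T.tube σ' t) '' Ico s 2 with hS
  have hSc : IsConnected S := (isConnected_Ico hs2).image _
    ((T.continuousOn_tube_left t).mono fun σ' hσ' => ⟨by linarith [hσ'.1, hp.1], hσ'.2⟩)
  have hSmiss : S ⊆ (range (R.collarLoop T σ h))ᶜ := by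
    rintro _ ⟨σ', hσ', rfl⟩ hmem
    rw [R.tube_mem_range_collarLoop_iff T hσ hh hh1 (by linarith [hσ'.1, hp.1]) hσ'.2] at hmem
    linarith [hσ'.1]
  have hSunb : ¬ IsBounded S := by
    -- it contains the outer escape from `max s (3/2)`
    obtain ⟨S', -, hS'unb, -, hS'sub⟩ := T.exists_outer_escape (s₀ := max s (3 / 2)) (by
      have : (3 : ℝ) / 2 ≤ max s (3 / 2) := le_max_right _ _; linarith) (max_lt hs2 (by norm_num)) t
    refine fun hb => hS'unb (hb.subset fun z hz => ?_)
    obtain ⟨σ', h1, h2, rfl⟩ := hS'sub z hz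
    exact ⟨σ', ⟨(le_max_left _ _).trans h1, h2⟩, rfl⟩
  intro hmem
  rw [R.mem_collarRect_iff T hσ hh hh1] at hmem
  have hzS : T.tube s t ∈ S := ⟨s, left_mem_Ico.2 hs2, rfl⟩
  exact hSunb (hmem.2.subset (hSc.isPreconnected.subset_connectedComponentIn hzS hSmiss))

/-- **The deep interior is inside the collar domain**: `Φ(u) ∈ collar` for `‖u‖ < 1 - h`. [folklore] -/
theorem apply_mem_collarRect {u : ℂ} (hu : ‖u‖ < 1 - h) : T.Ci.Φ u ∈ (R.collarRect T hσ hh hh1).carrier := by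
  -- `u = ‖u‖ β t` for the parameter `t` of the boundary point `Φ(u/‖u‖)`
  rcases eq_or_ne u 0 with rfl | hu0
  · rw [T.Ci_zero]; exact R.z₀_mem_collarRect T hσ hh hh1 hclose
  · have hn : 0 < ‖u‖ := norm_pos_iff.2 hu0
    set v : ℂ := ((‖u‖⁻¹ : ℝ) : ℂ) * u with hv
    have hv1 : ‖v‖ = 1 := by
      rw [hv, norm_mul, Complex.norm_real, Real.norm_eq_abs, abs_of_pos (inv_pos.2 hn), inv_mul_cancel₀ hn.ne']
    obtain ⟨t, ht⟩ : ∃ t, T.Ci.β t = v := by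
      have hfr : T.Ci.Φ v ∈ frontier R.carrier := T.Ci.apply_mem_frontier hv1
      rw [← R.range_boundary] at hfr
      obtain ⟨t, ht⟩ := hfr
      refine ⟨t, ?_⟩
      have h1 : T.Ci.Φ (T.Ci.β t) = T.Ci.Φ v := by rw [T.Ci.apply_β]; exact ht
      exact T.Ci.injOn (mem_closedBall_zero_iff.2 (T.Ci.norm_β t).le) (mem_closedBall_zero_iff.2 hv1.le) h1
    have hu' : u = ((‖u‖ : ℝ) : ℂ) * T.Ci.β t := by
      rw [ht, hv, ← mul_assoc, ← Complex.ofReal_mul, mul_inv_cancel₀ hn.ne', Complex.ofReal_one, one_mul]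
    have : T.Ci.Φ u = T.tube ‖u‖ t := by rw [T.tube_of_le_one (by linarith), ← hu']
    rw [this]
    exact R.tube_mem_collarRect T hσ hh hh1 hclose hn.le (by linarith [(R.profile_mem hσ hh t).1])

omit hclose in
/-- **Points of the collar domain outside `closure Ω` are shallow exterior tube points**: such a
point is `tube s t` with `1 < s < profile t` (so `profile t > 1`, i.e. `t` is on an arc pushed
outwards). [folklore] -/
theorem exists_eq_tube_of_mem_of_not_mem_closure {z : ℂ} (hz : z ∈ (R.collarRect T hσ hh hh1).carrier)
    (hzΩ : z ∉ closure R.carrier) : ∃ s t, 1 < s ∧ s < R.profile σ h t ∧ z = T.tube s t := by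
  -- `ι z ∈ Ω*` is `Φ*(u)` with `u ≠ 0` in the open disc
  have hw : invMap T.z₀ z ∈ (R.toJordanDomain.inverted T.hz₀).carrier := R.toJordanDomain.invMap_mem_inverted T.hz₀ hzΩ
  obtain ⟨u, hu, hwu⟩ := T.Ce.bijOn_ball.surjOn hw
  have hu1 : ‖u‖ < 1 := mem_ball_zero_iff.1 hu
  have hu0 : u ≠ 0 := by
    rintro rfl
    rw [T.Ce_zero] at hwu
    exact (invMap_eq_zero_iff.1 hwu.symm ▸ hzΩ) (subset_closure T.hz₀)
  have hn : 0 < ‖u‖ := norm_pos_iff.2 hu0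
  set v : ℂ := ((‖u‖⁻¹ : ℝ) : ℂ) * u with hv
  have hv1 : ‖v‖ = 1 := by
    rw [hv, norm_mul, Complex.norm_real, Real.norm_eq_abs, abs_of_pos (inv_pos.2 hn), inv_mul_cancel₀ hn.ne']
  obtain ⟨t, ht⟩ : ∃ t, T.Ce.β t = v := by
    have hfr : T.Ce.Φ v ∈ frontier (R.toJordanDomain.inverted T.hz₀).carrier := T.Ce.apply_mem_frontier hv1
    rw [← (R.toJordanDomain.inverted T.hz₀).range_boundary] at hfr
    obtain ⟨t, ht⟩ := hfr
    refine ⟨t, ?_⟩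
    have h1 : T.Ce.Φ (T.Ce.β t) = T.Ce.Φ v := by rw [T.Ce.apply_β]; exact ht
    exact T.Ce.injOn (mem_closedBall_zero_iff.2 (T.Ce.norm_β t).le) (mem_closedBall_zero_iff.2 hv1.le) h1
  have hu' : u = ((‖u‖ : ℝ) : ℂ) * T.Ce.β t := by
    rw [ht, hv, ← mul_assoc, ← Complex.ofReal_mul, mul_inv_cancel₀ hn.ne', Complex.ofReal_one, one_mul]
  have hzt : z = T.tube (2 - ‖u‖) t := by
    rw [T.tube_of_one_lt (by linarith), show (2 - (2 - ‖u‖) : ℝ) = ‖u‖ by ring, ← hu', hwu, invMapInv_invMap]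
  refine ⟨2 - ‖u‖, t, by linarith, ?_, hzt⟩
  by_contra hle
  push Not at hle
  rcases hle.eq_or_lt with he | hlt
  · -- on the loop: not in the (open) carrier
    have hfr : z ∈ frontier (R.collarRect T hσ hh hh1).carrier := by
      rw [R.frontier_collarRect T hσ hh hh1, hzt, R.tube_mem_range_collarLoop_iff T hσ hh hh1 (by linarith) (by linarith)]
      exact he.symm
    exact Set.disjoint_left.1 (R.collarRect T hσ hh hh1).disjoint_carrier_frontier hz hfr
  · exact R.tube_not_mem_collarRect T hσ hh hh1 hlt (by linarith) (hzt ▸ hz)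

omit hclose in
/-- **Points of the collar domain inside `Ω` near `∂Ω` are shallow interior tube points**: a point
of the collar domain of the form `Φ(u)` with `1 - h ≤ ‖u‖ < 1`… precisely, every point `z ∈ Ω` of
the collar domain is `Φ(u)` with `‖u‖ < 1`, and if `1/2 ≤ ‖u‖` then `z = tube ‖u‖ t` with
`‖u‖ < profile t`. [folklore] -/
theorem exists_eq_tube_of_mem_of_mem {z : ℂ} (hz : z ∈ (R.collarRect T hσ hh hh1).carrier) (hzΩ : z ∈ R.carrier) :
    ∃ u t, ‖u‖ < 1 ∧ z = T.Ci.Φ u ∧ (u ≠ 0 → u = ((‖u‖ : ℝ) : ℂ) * T.Ci.β t ∧ z = T.tube ‖u‖ t ∧ ‖u‖ < R.profile σ h t) := by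
  obtain ⟨u, hu, rfl⟩ := T.Ci.bijOn_ball.surjOn hzΩ
  have hu1 : ‖u‖ < 1 := mem_ball_zero_iff.1 hu
  rcases eq_or_ne u 0 with rfl | hu0
  · exact ⟨0, 0, by simp, rfl, fun h => absurd rfl h⟩
  have hn : 0 < ‖u‖ := norm_pos_iff.2 hu0
  set v : ℂ := ((‖u‖⁻¹ : ℝ) : ℂ) * u with hv
  have hv1 : ‖v‖ = 1 := by
    rw [hv, norm_mul, Complex.norm_real, Real.norm_eq_abs, abs_of_pos (inv_pos.2 hn), inv_mul_cancel₀ hn.ne']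
  obtain ⟨t, ht⟩ : ∃ t, T.Ci.β t = v := by
    have hfr : T.Ci.Φ v ∈ frontier R.carrier := T.Ci.apply_mem_frontier hv1
    rw [← R.range_boundary] at hfr
    obtain ⟨t, ht⟩ := hfr
    refine ⟨t, ?_⟩
    have h1 : T.Ci.Φ (T.Ci.β t) = T.Ci.Φ v := by rw [T.Ci.apply_β]; exact ht
    exact T.Ci.injOn (mem_closedBall_zero_iff.2 (T.Ci.norm_β t).le) (mem_closedBall_zero_iff.2 hv1.le) h1
  have hu' : u = ((‖u‖ : ℝ) : ℂ) * T.Ci.β t := by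
    rw [ht, hv, ← mul_assoc, ← Complex.ofReal_mul, mul_inv_cancel₀ hn.ne', Complex.ofReal_one, one_mul]
  have hzt : T.Ci.Φ u = T.tube ‖u‖ t := by rw [T.tube_of_le_one hu1.le, ← hu']
  refine ⟨u, t, hu1, rfl, fun _ => ⟨hu', hzt, ?_⟩⟩
  by_contra hle
  push Not at hle
  rcases hle.eq_or_lt with he | hlt
  · have hfr : T.Ci.Φ u ∈ frontier (R.collarRect T hσ hh hh1).carrier := by
      rw [R.frontier_collarRect T hσ hh hh1, hzt, R.tube_mem_range_collarLoop_iff T hσ hh hh1 hn.le (by linarith)]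
      exact he.symm
    exact Set.disjoint_left.1 (R.collarRect T hσ hh hh1).disjoint_carrier_frontier hz hfr
  · exact R.tube_not_mem_collarRect T hσ hh hh1 hlt (by linarith) (hzt ▸ hz)

end MarkedDomain

end Literature.Probability.RandomPlanarGeometry
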